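import Summits.ABC.ABC.Theorems.IsogenyGlueCongruencePolyDegreeOfBoundedPrimesHeightCalibration
import Summits.ABC.ABC.Theorems.IsogenyGlueCongruencePolyDegreeOfBoundedPrimesHeightCalibrationManin
import Summits.ABC.ABC.Theorems.IsogenyGlueCongruencePolyDegreeOfBoundedPrimesStubDegLeOfHeight
import Summits.ABC.ABC.Theorems.IsogenyGlueCongruencePolyDegreeOfBoundedPrimesStubOptimalDatumSemistable
import Literature.NumberTheory.EllipticCurves.NeronIsogenyScaling
import Literature.NumberTheory.EllipticCurves.ModularDegreeMinimal
import Literature.NumberTheory.EllipticCurves.PastenSpectralDegree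

/-!
# Optimal-curve calibration of crux B (`PolyDegreeOfBoundedPrimes`, stmt-ABC-2046, line `Sketch`, v5)

Crux B of route IsogenyGlueCongruence is `A → P` (`A = DegreePrimesPolyBounded`, `P` = the polynomial
modular-degree statement for semistable globally minimal elliptic `W/ℚ`, `∃ D, deg D ≤ C·N^κ`). The tree holds
the height calibration `B ↔ (A → H ∧ M)` (`polyDegreeOfBoundedPrimes_iff_height_and_manin`), with

* `H` — the polynomial HEIGHT conjecture for semistable curves, `max(|Δ_W|, |c₄(W)|³) ≤ C·N_W^σ`
  (Frey 1989; Pasten–Shimura 2024, Conj. 3.1, restricted to semistable curves; conjecture-grade), and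
* `M` — polynomially bounded Manin data (`∃ D, |c_D| ≤ M₀ N^a`; known in print, fact-grade).

This file REMOVES `M`: it is discharged modulo three NAMED FACTS of the tree, all known in print —

* `hEd`  : `Literature.NumberTheory.EllipticCurves.edixhoven_int_of_neronLattice_eq_smul_periodLattice`
  (Edixhoven 1991, Prop. 2 = Agashe–Ribet–Stein 2006, Thm. 2.2: the Manin constant of the strong Weil curve is
  an integer, lattice form);
* `hCes` : the universal closure of `ModularParametrizationData.abs_maninConstant_eq_one_of_isSemistable`
  (Česnavičius 2018, Thm. 1.2: the optimal datum of a semistable curve on a global minimal model has `|c| = 1`);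
* `h163` : `PastenShimura2024_minimalDegree_le_163_mul` (Mazur 1978, Thm. 1 + Kenku 1982; VERBATIM the route
  item `MazurKenkuBound`, stmt-ABC-15125) —

so that **`B ↔ (A → H)` modulo these facts** (`polyDegreeOfBoundedPrimes_iff_polyHeight_of_facts`, the
registered sub-goal of the line): crux B is EXACTLY "prime sizes of the modular degree ⟹ the polynomial height
(Szpiro) conjecture for semistable curves"; and since `P → A` trivially, the open content of B is `H` itself.

Mechanism (`polyDegreeGivenData_of_polyHeight_of_facts`, Murty 1999 Thm 1 (ii) run on the OPTIMAL curve and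
transferred by Mazur–Kenku): for a semistable globally minimal `W` of conductor `N` with SOME datum, take a
minimal datum `D₁` (`exists_minimal_datum`); `hEd` puts the class-optimal datum `D₀` on a GLOBALLY MINIMAL model
`W₀` (`exists_optimalDatum_of_edixhoven`), semistable of conductor `N` by Carayol's theorem at square-free level
(tree theorems) — landed stub `stub_optimalDatumSemistable` (p113553); `hCes` gives `|c₀| = 1`; Zagier +
Petersson-upper + Silverman-lower with `H` AT `W₀` give `deg D₀ ≤ K·N^κ` — landed stub `stub_degLeOfHeight`
(p113209); and `h163` gives `deg D₁ ≤ 163 · deg D₀`. Hypothesis A of the crux is used once: it supplies a datum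
of `W` (modularity). No definition, no new named fact; supports stmt-ABC-2046.

References: M. R. Murty, *Bounds for congruence primes* (1999), Thm 1 (ii), §2; H. Pasten, *Shimura curves and
the abc conjecture*, J. Number Theory 254 (2024), §3 p. 13, Conj. 3.1/3.2; B. Edixhoven, *On the Manin constants
of modular elliptic curves* (1991), Prop. 2; K. Česnavičius, *The Manin constant in the semistable case*,
Compositio Math. 154 (2018), Thm. 1.2; B. Mazur, *Rational isogenies of prime degree* (1978), Thm. 1;
M. A. Kenku (1982).
-/

noncomputable section

-- single-conjunct summit ABC: the duplicate ABC.ABC is mandated (CONVENTIONS §2)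
set_option linter.dupNamespace false

namespace Summit.ABC.ABC.Theorems

open Literature.NumberTheory.EllipticCurves Literature.NumberTheory.EllipticCurves.ModularForms
open CongruenceSubgroup
open Summit.ABC.ABC.Theses.IsogenyGlueCongruence

/-- **`P` given data, from `H` and the three named facts** (Murty 1999 Thm 1 (ii) on the optimal curve +
Mazur–Kenku): granted Edixhoven (lattice form), Česnavičius (`|c| = 1` for semistable optimal data on global
minimal models) and `deg D' ≤ 163 · deg D_opt`, the polynomial height hypothesis `H` yields `κ, C` such that every
semistable globally minimal elliptic `W/ℚ` of conductor `N` carrying SOME datum has a datum of degree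
`≤ C · N^κ` — namely a minimal datum `D₁`: the class-optimal datum `D₀` lives on a globally minimal semistable
`W₀` of conductor `N` (`stub_optimalDatumSemistable`), `|c₀| = 1`, `deg D₀ ≤ K N^κ` (`stub_degLeOfHeight` with
`H` at `W₀`), `deg D₁ ≤ 163 deg D₀`. [cite: MurtyCongruencePrimes1999, Thm. 1 (ii) and §2]
[cite: PastenShimura2024, §3 p. 13] -/
theorem polyDegreeGivenData_of_polyHeight_of_facts
    (hEd : edixhoven_int_of_neronLattice_eq_smul_periodLattice)
    (hCes : ∀ {W' : WeierstrassCurve ℚ} {N' : ℕ} [NeZero N']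
      (D' : ModularParametrizationData W' N'), D'.abs_maninConstant_eq_one_of_isSemistable)
    (h163 : PastenShimura2024_minimalDegree_le_163_mul)
    (hH : ∃ σ C : ℝ, ∀ (W : WeierstrassCurve ℚ) [W.IsElliptic] [W.IsGloballyMinimal]
      [NeZero (W.conductorNorm ℤ)], W.IsSemistable ℤ →
      ((max |W.Δ| (|W.c₄| ^ 3) : ℚ) : ℝ) ≤ C * (W.conductorNorm ℤ : ℝ) ^ σ) :
    ∃ κ C : ℝ, ∀ (W : WeierstrassCurve ℚ) [W.IsElliptic] [W.IsGloballyMinimal]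
      [NeZero (W.conductorNorm ℤ)], W.IsSemistable ℤ →
      Nonempty (ModularParametrizationData W (W.conductorNorm ℤ)) →
      ∃ D : ModularParametrizationData W (W.conductorNorm ℤ),
        (D.modularDegree : ℝ) ≤ C * (W.conductorNorm ℤ : ℝ) ^ κ := by
  obtain ⟨σ, CH, hH⟩ := hH
  obtain ⟨κ, K, hK⟩ := stub_degLeOfHeight σ CH 1
  refine ⟨κ, 163 * max K 0, fun W _ _ _ hss hne ↦ ?_⟩
  -- a minimal datum of `W`
  obtain ⟨D₁, -, hmin₁⟩ := exists_minimal_datum hne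
  have hsq : Squarefree (W.conductorNorm ℤ) := (W.isSemistable_iff_squarefree_conductorNorm).mp hss
  -- the class-optimal datum on a globally minimal semistable model of conductor `N`
  obtain ⟨W₀, hW₀, hW₀', D₀, hf₀, hss₀, hN₀, -, hmin₀⟩ :=
    stub_optimalDatumSemistable hEd (W.conductorNorm ℤ) W D₁ hsq
  haveI := hW₀
  haveI := hW₀'
  -- Česnavičius: `|c₀| = 1`
  have hc₀ : |D₀.maninConstant| = 1 := hCes D₀ hss₀ hmin₀
  have hc₀' : |(D₀.maninConstant : ℝ)| ≤ 1 := by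
    rw [← Int.cast_abs, hc₀, Int.cast_one]
  -- `H` at `W₀` (conductor `N`)
  haveI : NeZero (W₀.conductorNorm ℤ) := ⟨by rw [hN₀]; exact NeZero.ne _⟩
  have hH₀ : ((max |W₀.Δ| (|W₀.c₄| ^ 3) : ℚ) : ℝ) ≤ CH * (W.conductorNorm ℤ : ℝ) ^ σ := by
    have h := hH W₀ hss₀
    rwa [hN₀] at h
  -- the degree of the optimal datum, and the Mazur–Kenku transfer
  have hdeg₀ : (D₀.modularDegree : ℝ) ≤ K * (W.conductorNorm ℤ : ℝ) ^ κ :=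
    hK (W.conductorNorm ℤ) W₀ D₀ hsq hH₀ hc₀'
  have h163' : D₁.modularDegree ≤ 163 * D₀.modularDegree :=
    h163 (W.conductorNorm ℤ) W₀ W D₀ D₁ hf₀.symm hmin₀ hmin₁
  refine ⟨D₁, ?_⟩
  have hNκ : (0 : ℝ) ≤ (W.conductorNorm ℤ : ℝ) ^ κ := by positivity
  calc (D₁.modularDegree : ℝ) ≤ 163 * (D₀.modularDegree : ℝ) := by exact_mod_cast h163'
    _ ≤ 163 * (K * (W.conductorNorm ℤ : ℝ) ^ κ) := by gcongr
    _ ≤ 163 * (max K 0 * (W.conductorNorm ℤ : ℝ) ^ κ) := by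
        gcongr
        exact le_max_left _ _
    _ = 163 * max K 0 * (W.conductorNorm ℤ : ℝ) ^ κ := by ring

/-- **`H → B` modulo the three named facts** (the direction the line adds; hypothesis A of the crux supplies
the datum of `W`, its only use). [cite: MurtyCongruencePrimes1999, Thm. 1 (ii) and §2] -/
theorem polyDegreeOfBoundedPrimes_of_polyHeight_of_facts
    (hEd : edixhoven_int_of_neronLattice_eq_smul_periodLattice)
    (hCes : ∀ {W' : WeierstrassCurve ℚ} {N' : ℕ} [NeZero N']
      (D' : ModularParametrizationData W' N'), D'.abs_maninConstant_eq_one_of_isSemistable)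
    (h163 : PastenShimura2024_minimalDegree_le_163_mul)
    (hH : ∃ σ C : ℝ, ∀ (W : WeierstrassCurve ℚ) [W.IsElliptic] [W.IsGloballyMinimal]
      [NeZero (W.conductorNorm ℤ)], W.IsSemistable ℤ →
      ((max |W.Δ| (|W.c₄| ^ 3) : ℚ) : ℝ) ≤ C * (W.conductorNorm ℤ : ℝ) ^ σ) :
    PolyDegreeOfBoundedPrimes := by
  intro hA
  obtain ⟨κ, C, h⟩ := polyDegreeGivenData_of_polyHeight_of_facts hEd hCes h163 hH
  obtain ⟨κA, CA, hA⟩ := hA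
  refine ⟨κ, C, fun W _ _ _ hss ↦ ?_⟩
  obtain ⟨DA, -⟩ := hA W hss
  exact h W hss ⟨DA⟩

/-- **`B ↔ (A → H)` modulo the three named facts** — crux B IS the polynomial height (Szpiro) conjecture for
semistable curves, granted crux A: `→` is the unconditional `polyHeight_of_polyDegreeOfBoundedPrimes` (Zagier +
Hoffstein–Lockhart + Silverman, p102896), `←` is `polyDegreeOfBoundedPrimes_of_polyHeight_of_facts`. Registered
sub-goal of stmt-ABC-2046 (line `Sketch`, v5): name + one-line signature verbatim.
[cite: MurtyCongruencePrimes1999, Thm. 1 and §2] [cite: PastenShimura2024, §3 p. 13 and Conj. 3.1] -/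
theorem polyDegreeOfBoundedPrimes_iff_polyHeight_of_facts : Literature.NumberTheory.EllipticCurves.edixhoven_int_of_neronLattice_eq_smul_periodLattice → (∀ {W' : WeierstrassCurve ℚ} {N' : ℕ} [NeZero N'] (D' : Literature.NumberTheory.EllipticCurves.ModularForms.ModularParametrizationData W' N'), D'.abs_maninConstant_eq_one_of_isSemistable) → Literature.NumberTheory.EllipticCurves.ModularForms.PastenShimura2024_minimalDegree_le_163_mul → (Summit.ABC.ABC.Theses.IsogenyGlueCongruence.PolyDegreeOfBoundedPrimes ↔ (Summit.ABC.ABC.Theses.IsogenyGlueCongruence.DegreePrimesPolyBounded → ∃ σ C : ℝ, ∀ (W : WeierstrassCurve ℚ) [W.IsElliptic] [W.IsGloballyMinimal] [NeZero (W.conductorNorm ℤ)], W.IsSemistable ℤ → ((max |W.Δ| (|W.c₄| ^ 3) : ℚ) : ℝ) ≤ C * (W.conductorNorm ℤ : ℝ) ^ σ)) :=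
  fun hEd hCes h163 ↦ ⟨fun hB hA ↦ polyHeight_of_polyDegreeOfBoundedPrimes hB hA,
    fun h hA ↦ polyDegreeOfBoundedPrimes_of_polyHeight_of_facts hEd hCes h163 (h hA) hA⟩

/-- The same with the route ITEM `MazurKenkuBound` (stmt-ABC-15125), which repeats the Literature fact
`PastenShimura2024_minimalDegree_le_163_mul` verbatim. [cite: PastenShimura2024, §3 p. 13] -/
theorem polyDegreeOfBoundedPrimes_iff_polyHeight_of_mazurKenku
    (hEd : edixhoven_int_of_neronLattice_eq_smul_periodLattice)
    (hCes : ∀ {W' : WeierstrassCurve ℚ} {N' : ℕ} [NeZero N']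
      (D' : ModularParametrizationData W' N'), D'.abs_maninConstant_eq_one_of_isSemistable)
    (hMK : MazurKenkuBound) :
    PolyDegreeOfBoundedPrimes ↔ (DegreePrimesPolyBounded →
      ∃ σ C : ℝ, ∀ (W : WeierstrassCurve ℚ) [W.IsElliptic] [W.IsGloballyMinimal]
        [NeZero (W.conductorNorm ℤ)], W.IsSemistable ℤ →
        ((max |W.Δ| (|W.c₄| ^ 3) : ℚ) : ℝ) ≤ C * (W.conductorNorm ℤ : ℝ) ^ σ) :=
  polyDegreeOfBoundedPrimes_iff_polyHeight_of_facts hEd hCes hMK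

/-- **`P ↔ H` modulo the named facts and modularity** (`nonempty_modularParametrizationData` = route item
`ModularDatumExists`, stmt-ABC-15126): the consequent of crux B is the polynomial height conjecture for
semistable curves; `→` unconditional (`polyHeight_of_polyDegree`). [cite: MurtyCongruencePrimes1999, Thm. 1 and §2] -/
theorem polyDegree_iff_polyHeight_of_facts
    (hEd : edixhoven_int_of_neronLattice_eq_smul_periodLattice)
    (hCes : ∀ {W' : WeierstrassCurve ℚ} {N' : ℕ} [NeZero N']
      (D' : ModularParametrizationData W' N'), D'.abs_maninConstant_eq_one_of_isSemistable)
    (h163 : PastenShimura2024_minimalDegree_le_163_mul)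
    (hMod : nonempty_modularParametrizationData) :
    (∃ κ C : ℝ, ∀ (W : WeierstrassCurve ℚ) [W.IsElliptic] [W.IsGloballyMinimal]
      [NeZero (W.conductorNorm ℤ)], W.IsSemistable ℤ →
      ∃ D : ModularParametrizationData W (W.conductorNorm ℤ),
        (D.modularDegree : ℝ) ≤ C * (W.conductorNorm ℤ : ℝ) ^ κ) ↔
    (∃ σ C : ℝ, ∀ (W : WeierstrassCurve ℚ) [W.IsElliptic] [W.IsGloballyMinimal]
      [NeZero (W.conductorNorm ℤ)], W.IsSemistable ℤ →
      ((max |W.Δ| (|W.c₄| ^ 3) : ℚ) : ℝ) ≤ C * (W.conductorNorm ℤ : ℝ) ^ σ) := by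
  refine ⟨fun hP ↦ polyHeight_of_polyDegree hP, fun hH ↦ ?_⟩
  obtain ⟨κ, C, h⟩ := polyDegreeGivenData_of_polyHeight_of_facts hEd hCes h163 hH
  exact ⟨κ, C, fun W _ _ _ hss ↦ h W hss (hMod W)⟩

/-- **The Manin input `M` is now superfluous**: modulo the three named facts, `H` alone gives back BOTH halves
of the earlier calibration `B ↔ (A → H ∧ M)` — the bounded-Manin statement `M` follows from `H` (through
`P`, by the landed `manin_of_polyDegree`, p104128) as soon as every semistable globally minimal curve has a
datum (`nonempty_modularParametrizationData`). [cite: MurtyCongruencePrimes1999, §2] -/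
theorem manin_of_polyHeight_of_facts
    (hEd : edixhoven_int_of_neronLattice_eq_smul_periodLattice)
    (hCes : ∀ {W' : WeierstrassCurve ℚ} {N' : ℕ} [NeZero N']
      (D' : ModularParametrizationData W' N'), D'.abs_maninConstant_eq_one_of_isSemistable)
    (h163 : PastenShimura2024_minimalDegree_le_163_mul)
    (hMod : nonempty_modularParametrizationData)
    (hH : ∃ σ C : ℝ, ∀ (W : WeierstrassCurve ℚ) [W.IsElliptic] [W.IsGloballyMinimal]
      [NeZero (W.conductorNorm ℤ)], W.IsSemistable ℤ →
      ((max |W.Δ| (|W.c₄| ^ 3) : ℚ) : ℝ) ≤ C * (W.conductorNorm ℤ : ℝ) ^ σ) :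
    ∃ a M₀ : ℝ, ∀ (W : WeierstrassCurve ℚ) [W.IsElliptic] [W.IsGloballyMinimal]
      [NeZero (W.conductorNorm ℤ)], W.IsSemistable ℤ →
      ∃ D : ModularParametrizationData W (W.conductorNorm ℤ),
        |(D.maninConstant : ℝ)| ≤ M₀ * (W.conductorNorm ℤ : ℝ) ^ a :=
  manin_of_polyDegree ((polyDegree_iff_polyHeight_of_facts hEd hCes h163 hMod).mpr hH)

end Summit.ABC.ABC.Theorems

end
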